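import Literature.NumberTheory.GaloisRepresentations.LabelledHodgeTateWeights
import HarnessLib

/-!
# Rank-one representations and periods: admissibility and the Hodge–Tate weight from one period

Generic `p`-adic Hodge theory of CHARACTERS for an arbitrary period-ring datum
`𝔅 : PeriodRingData Γ P E` (accepted `PAdicHodge`): a continuous rank-one representation
`ρ : Γ → GL_1(P)`, i.e. a character `χ = ρ(·)(1) : Γ → Pˣ` (`PeriodRingData.chi`), and

* `PeriodRingData.Dtw 𝔅 ρ = {b ∈ B | χ(σ)·σ(b) = b}` — Fontaine's `D_B(χ) = (B ⊗_P P(χ))^Γ`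
  transported along `B ⊗_P P ≅ B` (`map_D_eq_Dtw`, `finrank_D_eq`);
* **one nonzero period suffices** (`Dtw_eq_span`, `finrank_Dtw`, `isAdmissible_of_period`): if
  `s ∈ B`, `s ≠ 0`, satisfies `χ(σ)·σ(s) = s` for all `σ` then `D_B(χ) = E·s` is a line and `χ`
  is `𝔅`-admissible — by Fontaine's regularity axiom (ii) (`exists_smul_eq`: `b/s ∈ (Frac B)^Γ = E`);
* **the Hodge–Tate weight is read off the period** (`finrank_filD_eq`, `hodgeTateWeights_eq`): if
  moreover `s ∈ Fil^i B ↔ i ≤ w`, then `dim_E Fil^i D_B(χ) = 1` for `i ≤ w` and `0` otherwise, so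
  the multiset of Hodge–Tate weights of `χ` (accepted `PeriodRingData.hodgeTateWeights`) is `{w}`.

Instances: `B = B_HT`, `χ` cyclotomic, `s = T⁻¹`, `w = -1` (accepted `HodgeTateCyclotomic`);
`B = B_dR`, `χ` cyclotomic, `s = t⁻¹`, `w = -1` (Fontaine 1994, Exp. III §1.5, Exp. II §1.5.5:
`σ t = χ(σ) t`, `Fil^i = t^i B_dR⁺`). All statements are [folklore] consequences of Fontaine's
formalism (Astérisque 223, Exp. III §1.3–1.5).

## References
* [FontaineAsterisque223III] J.-M. Fontaine, *Représentations p-adiques semi-stables*,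
  Astérisque 223 (1994), Exp. III, §1.3–1.5.
* [FontaineOuyang2022] J.-M. Fontaine, Y. Ouyang, *Theory of p-adic Galois representations*, §5.1.
-/

noncomputable section

open scoped TensorProduct

namespace Literature.NumberTheory.GaloisRepresentations

namespace PeriodRingData

universe u v v' w

variable {Γ : Type u} [Group Γ] [TopologicalSpace Γ] {P : Type v} {E : Type v'} [Field P]
  [TopologicalSpace P] [Field E] [Algebra P E]
  (𝔅 : PeriodRingData.{u, v, v', w} Γ P E) (ρ : ContinuousRep Γ P P)

/-! ### The character of a rank-one representation -/

/-- The character `χ(σ) = ρ(σ)(1) ∈ P` of a rank-one representation `ρ : Γ → GL_1(P)`. [folklore] -/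
def chi (ρ : ContinuousRep Γ P P) (σ : Γ) : P := ρ σ 1

/-- `ρ(σ)(c) = χ(σ)·c`. [folklore] -/
theorem apply_eq_chi_mul (σ : Γ) (c : P) : ρ σ c = chi ρ σ * c := by
  have h : ρ σ (c • (1 : P)) = c • ρ σ 1 := LinearMap.map_smul _ _ _
  rw [smul_eq_mul, mul_one, smul_eq_mul] at h
  rw [h, chi, mul_comm]

/-- `χ(1) = 1`. [folklore] -/
theorem chi_one : chi ρ 1 = 1 := by
  change ρ 1 1 = 1
  rw [map_one ρ]; rfl

/-- `χ(στ) = χ(σ)χ(τ)`. [folklore] -/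
theorem chi_mul (σ τ : Γ) : chi ρ (σ * τ) = chi ρ σ * chi ρ τ := by
  rw [chi, map_mul, Module.End.mul_apply, ← chi, apply_eq_chi_mul]

/-- `χ(σ) ≠ 0`. [folklore] -/
theorem chi_ne_zero (σ : Γ) : chi ρ σ ≠ 0 := by
  refine left_ne_zero_of_mul_eq_one (b := chi ρ σ⁻¹) ?_
  rw [← chi_mul, mul_inv_cancel, chi_one]

/-! ### `D_B(χ)` transported to `B` -/

/-- **The twisted action `b ↦ χ(σ)·σ(b)`** on `B` (the diagonal action on `B ⊗_P P(χ)` transported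
to `B`). [cite: FontaineOuyang2022, §5.1] -/
def twisted (σ : Γ) (b : 𝔅.B) : 𝔅.B := algebraMap P 𝔅.B (chi ρ σ) * σ • b

omit [TopologicalSpace Γ] [TopologicalSpace P] in
/-- `Γ` fixes the image of `P` in `B`. [folklore] -/
theorem smul_algebraMap_P (σ : Γ) (c : P) : σ • algebraMap P 𝔅.B c = algebraMap P 𝔅.B c := by
  rw [Algebra.algebraMap_eq_smul_one, smul_comm, smul_one]

/-- The identification `B ⊗_P P ≅ B` (`E`-linear). [folklore] -/
def ridB : 𝔅.B ⊗[P] P ≃ₗ[E] 𝔅.B := TensorProduct.AlgebraTensorModule.rid P E 𝔅.B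

omit [TopologicalSpace Γ] [TopologicalSpace P] in
/-- Unfolding of `ridB` on pure tensors. [folklore] -/
theorem ridB_tmul (b : 𝔅.B) (c : P) : 𝔅.ridB (b ⊗ₜ c) = c • b := rfl

/-- **Transport of the diagonal action**: under `B ⊗_P P(χ) ≅ B`, `σ ⊗ ρ(σ)` becomes `b ↦ χ(σ)σ(b)`.
[cite: FontaineOuyang2022, §5.1] -/
theorem ridB_tensorRep (σ : Γ) (x : 𝔅.B ⊗[P] P) :
    𝔅.ridB (𝔅.tensorRep ρ σ x) = 𝔅.twisted ρ σ (𝔅.ridB x) := by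
  induction x using TensorProduct.induction_on with
  | zero => rw [map_zero, map_zero, twisted, smul_zero, mul_zero]
  | tmul b c =>
    rw [tensorRep_apply_tmul, apply_eq_chi_mul, ridB_tmul, ridB_tmul, twisted, mul_smul, Algebra.smul_def,
      Algebra.smul_def, Algebra.smul_def, smul_mul', smul_algebraMap_P]
  | add x y hx hy => rw [map_add, map_add, hx, hy, twisted, twisted, twisted, map_add, smul_add, mul_add]

/-- **`D_B(χ)` transported to `B`**: `{b | χ(σ)σ(b) = b for all σ}`, an `E`-submodule of `B`. [folklore] -/
def Dtw : Submodule E 𝔅.B where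
  carrier := {b | ∀ σ : Γ, 𝔅.twisted ρ σ b = b}
  zero_mem' := fun σ => by rw [twisted, smul_zero, mul_zero]
  add_mem' := by
    intro a b ha hb σ
    rw [twisted, smul_add, mul_add, ← twisted, ← twisted, ha σ, hb σ]
  smul_mem' := by
    intro e b hb σ
    change 𝔅.twisted ρ σ (e • b) = e • b
    rw [twisted, smul_comm σ e b, mul_smul_comm, ← twisted, hb σ]

/-- Membership in `Dtw`. [folklore] -/
theorem mem_Dtw_iff {b : 𝔅.B} : b ∈ 𝔅.Dtw ρ ↔ ∀ σ : Γ, 𝔅.twisted ρ σ b = b := Iff.rfl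

/-- The invariants `D_B(χ) = (B ⊗ P(χ))^Γ` correspond to `Dtw` under `ridB`. [folklore] -/
theorem map_D_eq_Dtw : (𝔅.D ρ).map (𝔅.ridB : 𝔅.B ⊗[P] P →ₗ[E] 𝔅.B) = 𝔅.Dtw ρ := by
  ext b
  constructor
  · rintro ⟨x, hx, rfl⟩ σ
    rw [LinearEquiv.coe_coe, ← ridB_tensorRep, (𝔅.mem_D_iff ρ x).mp hx σ]
  · intro hb
    refine ⟨𝔅.ridB.symm b, ?_, by simp⟩
    rw [SetLike.mem_coe, mem_D_iff]
    intro σ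
    apply 𝔅.ridB.injective
    rw [ridB_tensorRep, LinearEquiv.apply_symm_apply, hb σ]

/-- `dim_E D_B(χ) = dim_E Dtw`. [folklore] -/
theorem finrank_D_eq : Module.finrank E (𝔅.D ρ) = Module.finrank E (𝔅.Dtw ρ) := by
  rw [(𝔅.ridB.submoduleMap (𝔅.D ρ)).finrank_eq, ← map_D_eq_Dtw]

/-! ### One nonzero period makes `χ` admissible -/

section Period

variable {𝔅 ρ} {s : 𝔅.B} (hs0 : s ≠ 0) (hs : ∀ σ : Γ, algebraMap P 𝔅.B (chi ρ σ) * σ • s = s)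
include hs

/-- A period `s` (`χ(σ)σ(s) = s`) lies in `Dtw`. [folklore] -/
theorem period_mem_Dtw : s ∈ 𝔅.Dtw ρ := hs

include hs0 in
/-- **`D_B(χ) = E·s` for any nonzero period `s`** (Fontaine's regularity (ii): for `b ∈ D_B(χ)`,
`b/s` is `Γ`-invariant, hence in `E`). [cite: FontaineAsterisque223III, Exp. III §1.4–1.5] -/
theorem Dtw_eq_span : 𝔅.Dtw ρ = E ∙ s := by
  apply le_antisymm
  · intro b hb
    have hcomm : ∀ σ : Γ, σ • b * s = b * σ • s := by
      intro σ
      have h1 := hb σ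
      have h2 := hs σ
      rw [twisted] at h1
      calc σ • b * s = σ • b * (algebraMap P 𝔅.B (chi ρ σ) * σ • s) := by rw [h2]
        _ = (algebraMap P 𝔅.B (chi ρ σ) * σ • b) * σ • s := by ring
        _ = b * σ • s := by rw [h1]
    obtain ⟨e, he⟩ := 𝔅.exists_smul_eq b s hs0 hcomm
    exact Submodule.mem_span_singleton.2 ⟨e, he.symm⟩
  · rw [Submodule.span_le, Set.singleton_subset_iff]
    exact hs

include hs0 in
/-- `dim_E D_B(χ) = 1` (transported form). [cite: FontaineOuyang2022, §5.1] -/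
theorem finrank_Dtw : Module.finrank E (𝔅.Dtw ρ) = 1 := by
  rw [Dtw_eq_span hs0 hs]
  exact finrank_span_singleton hs0

include hs0 in
/-- `dim_E D_B(χ) = 1`. [cite: FontaineOuyang2022, §5.1] -/
theorem finrank_D_of_period : Module.finrank E (𝔅.D ρ) = 1 := by
  rw [finrank_D_eq, finrank_Dtw hs0 hs]

include hs0 in
/-- **A character with a nonzero period is `𝔅`-admissible.** [cite: FontaineAsterisque223III, Exp. III §1.5] -/
theorem isAdmissible_of_period : 𝔅.IsAdmissible ρ := by
  rw [IsAdmissible, finrank_D_of_period hs0 hs, Module.finrank_self]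

end Period

/-! ### The filtration on `D_B(χ)` and the Hodge–Tate weight -/

omit [TopologicalSpace Γ] [TopologicalSpace P] in
/-- Under `B ⊗_P P ≅ B`, `Fil^i B ⊗ P` is `Fil^i B`. [folklore] -/
theorem map_filTensor (i : ℤ) :
    (𝔅.filTensor P i).map (𝔅.ridB : 𝔅.B ⊗[P] P →ₗ[E] 𝔅.B) = 𝔅.fil i := by
  apply le_antisymm
  · rintro _ ⟨x, ⟨y, rfl⟩, rfl⟩
    rw [LinearEquiv.coe_coe]
    induction y using TensorProduct.induction_on with
    | zero => rw [map_zero, map_zero]; exact zero_mem _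
    | tmul f c =>
      rw [TensorProduct.AlgebraTensorModule.map_tmul, Submodule.subtype_apply, LinearMap.id_apply,
        ridB_tmul, ← algebraMap_smul E c (f : 𝔅.B)]
      exact Submodule.smul_mem _ _ f.2
    | add x y hx hy => rw [map_add, map_add]; exact add_mem hx hy
  · intro f hf
    refine ⟨TensorProduct.AlgebraTensorModule.map (𝔅.fil i).subtype LinearMap.id
      (((⟨f, hf⟩ : 𝔅.fil i)) ⊗ₜ (1 : P)), ⟨_, rfl⟩, ?_⟩
    rw [LinearEquiv.coe_coe, TensorProduct.AlgebraTensorModule.map_tmul, Submodule.subtype_apply,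
      LinearMap.id_apply, ridB_tmul, one_smul]

/-- `dim_E Fil^i D_B(χ) = dim_E (Dtw ∩ Fil^i B)`. [folklore] -/
theorem finrank_filD (i : ℤ) :
    Module.finrank E (𝔅.filD ρ i) = Module.finrank E ((𝔅.Dtw ρ ⊓ 𝔅.fil i : Submodule E 𝔅.B)) := by
  have hinj : Function.Injective (𝔅.D ρ).subtype := Subtype.val_injective
  rw [(Submodule.equivMapOfInjective _ hinj (𝔅.filD ρ i)).finrank_eq, filD, Submodule.map_comap_subtype,
    (Submodule.equivMapOfInjective (𝔅.ridB : 𝔅.B ⊗[P] P →ₗ[E] 𝔅.B) 𝔅.ridB.injective _).finrank_eq,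
    Submodule.map_inf _ 𝔅.ridB.injective, map_D_eq_Dtw, map_filTensor]

section Period

variable {𝔅 ρ} {s : 𝔅.B} (hs0 : s ≠ 0) (hs : ∀ σ : Γ, algebraMap P 𝔅.B (chi ρ σ) * σ • s = s)
  {w : ℤ} (hfil : ∀ i : ℤ, s ∈ 𝔅.fil i ↔ i ≤ w)
include hs0 hs hfil

/-- **`dim_E Fil^i D_B(χ) = 1` for `i ≤ w` and `0` for `i > w`**, when the period `s` lies in
`Fil^i B` exactly for `i ≤ w`. [cite: FontaineOuyang2022, §5.1] -/
theorem finrank_filD_eq (i : ℤ) : Module.finrank E (𝔅.filD ρ i) = if i ≤ w then 1 else 0 := by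
  rw [finrank_filD, Dtw_eq_span hs0 hs]
  split_ifs with hi
  · have hle : (E ∙ s) ≤ 𝔅.fil i := by
      rw [Submodule.span_le, Set.singleton_subset_iff]
      exact (hfil i).2 hi
    rw [inf_eq_left.mpr hle]
    exact finrank_span_singleton hs0
  · have hbot : (E ∙ s) ⊓ 𝔅.fil i = ⊥ := by
      rw [eq_bot_iff]
      rintro x ⟨hx1, hx2⟩
      rw [SetLike.mem_coe, Submodule.mem_span_singleton] at hx1
      obtain ⟨e, rfl⟩ := hx1
      by_cases he : e = 0
      · rw [he, zero_smul]; exact Submodule.zero_mem _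
      · exfalso
        refine hi ((hfil i).1 ?_)
        have h := Submodule.smul_mem (𝔅.fil i) e⁻¹ hx2
        rwa [inv_smul_smul₀ he] at h
    rw [hbot, finrank_bot]

/-- **The Hodge–Tate weights of `χ` are `{w}`.** [cite: FontaineOuyang2022, §5.1] -/
theorem hodgeTateWeights_eq : 𝔅.hodgeTateWeights ρ = {w} := by
  rw [hodgeTateWeights_eq_jumpMultiset]
  have hfr : (fun i => Module.finrank E (𝔅.filD ρ i)) = fun i => if i ≤ w then 1 else 0 :=
    funext fun i => finrank_filD_eq hs0 hs hfil i
  rw [hfr, jumpMultiset_step]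
  rfl

end Period

end PeriodRingData

end Literature.NumberTheory.GaloisRepresentations

end
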